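import Literature.MathematicalPhysics.QuantumFieldTheory.Balaban1983to89.B5Strip145Decay
import Literature.MathematicalPhysics.QuantumFieldTheory.Balaban1983to89.B4TorusKernel

/-!
# `Balaban1983to89.B5Torus145Decay` — the torus joiner: `k`- and volume-uniform exponential decay of the FINITE-TORUS kernel of
`(Q′G′²Q′*)⁻¹` (B5 (1.45))

T. Bałaban, *Propagators and renormalization transformations for lattice gauge theories. I*, Commun. Math. Phys. **95**, 17–40
(1984) [Balaban1984PropagatorsI] (cell paper B5): p. 25 [PDF 9] l. 35–36, p. 26 [PDF 10] (1.45), p. 36 [PDF 20] l. 20–23 and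
p. 38 [PDF 22], the sentence before (1.126); method of T. Bałaban, *Regularity and decay of lattice Green's functions*, Commun.
Math. Phys. **89**, 571–597 (1983) [Balaban1983RegularityDecay] (cell paper B4 = B5's [2]), p. 586 [PDF 16] l. 9–15.

CITATION HEADER (lean-in-tree rule 2026-08-18).  This module is a SUPPLEMENT, not a quotation.  B5 states the operator of
(1.45) lives on a finite torus — p. 25 [PDF 9] l. 35–36, verbatim: *"It is a translation invariant operator on the unit lattice
T₁^{(k)} and its Fourier transform can be written using formula (2.48)"* — and disposes of finite-volume decay by reference to
infinite volume — p. 36 [PDF 20] l. 20–23, verbatim: *"Probably the simplest proof of the exponential decay properties can be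
obtained by relating G on the torus to G on the whole lattice ηZ^d in the usual way"*; the decay itself is asserted on p. 38
[PDF 22], the sentence before (1.126), verbatim: *"They follow from the representation P = G′Q′*(Q′G′²Q′*)⁻¹Q′G′, from Lemma
2.4 of [2], and the representation (1.45) and the analyticity method of proving an exponential decay (see the proof of Lemma
2.4 in [2])"*, with *"The constant O(1) in (1.126) depends on d only"*.  Neither paper writes the finite-torus argument.  The
cell supplies it in kernel modules, all IMPORTED here untouched: `B5Strip145Decay` (b04-g3: `stripRegular_inverse145` — the
inverse multiplier `1/mReg = E²/𝒩 = (Q′G′²Q′*)⁻¹(p′)` is strip regular with bound `c⁻¹` from the zero-free uniform strip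
`B5Strip145Leaves.uniformStrip145_holds`, hypothesis `0 < a₋` only — and `inverse145_kernel_decay`, the infinite-volume
kernel) and the generic torus engine `B4TorusKernel` of this seat (`torusKernel_descend_eq`: the torus kernel of a strip-regular
multiplier sampled at the dual-torus momenta IS the periodisation `Σ_m K(x + Nm)` of its lattice kernel — Poisson summation on
`(ℤ/N)^{d+1}`; `torusKernel_descend_decay`: hence it decays at rate `κ/(d+1)` in the torus distance with constant
`M · periodConst κ d`, UNIFORMLY in the period `N`).  THIS FILE IS THE ≈ 60-line TORUS JOINER (journal claim C-B5-18-TORUS-JOINER,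
answering `B5Strip145Decay`'s NOT-covered item *"the finite-torus kernel on T₁^{(k)} actually used in B5 (a Poisson
periodisation of latticeKernel)"*):
* `torusKernel145 n a N x = N^{-(d+1)} Σ_{k ∈ (ℤ/N)^{d+1}} (mReg_{n,a}(2π rep(k/N)))⁻¹ e^{2πi k·x/N}` — the kernel, at lattice
  separation `x ∈ ℤ^{d+1}`, of the inverse multiplier on the discrete torus of EQUAL periods `N` (dual momenta
  `p′_μ = 2π rep(k_μ/N) ∈ (2π/N)ℤ ∩ [−π, π)`; for `N = 2L′` these are B5's `p_μ = (π/L′)n_μ`, `−L′ ≤ n_μ < L′`, (1.29) with `η = 1`: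
  `rep_grid`); an explicit finite sum, no proof terms inside the statement;
* `torusKernel145_eq_torusKernel` — it is `B4TorusKernel.torusKernel (descendC (1/mReg) …) N x` (definitional);
* `torusKernel145_eq_periodise (ha : 0 < a)` — `torusKernel145 n a N x = Σ_{m ∈ ℤ^{d+1}} latticeKernel (1/mReg_{n,a}) (x + Nm)`
  ("relating G on the torus to G on the whole lattice … in the usual way");
* **`inverse145_torusKernel_decay (ha : 0 < a₋)`** — `∃ κ > 0, c > 0, ∀ n ≥ 1, ∀ a ∈ [a₋, a₊], ∀ N ≥ 1, ∀ x` centred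
  (`2|x_i| ≤ N`): `‖torusKernel145 n a N x‖ ≤ c⁻¹ · periodConst κ d · e^{−(κ/(d+1)) |x|_∞}` — the finite-torus decay input of
  (1.126) for the factor `(Q′G′²Q′*)⁻¹`, constants depending on `d, a₋, a₊` only, UNIFORM in `k` (through `n = L^k`) AND in the
  volume `N`.  ONLY HYPOTHESIS: `0 < a₋`.
* UNEQUAL PERIODS (v2, last section; via `B4TorusKernel` §7 `MultiPeriod`): `torusKernel145M n a N x` for a period VECTOR
  `N : Fin (d+1) → ℕ` — the tori B5 actually writes, `{−L_μ ≤ x_μ < L_μ}` (p. 17 l. 30) with dual momenta `−L′_μ ≤ n_μ < L′_μ`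
  (1.29) —, `torusKernel145M_eq_torusKernel` (definitional), `torusKernel145M_const` (constant vector = `torusKernel145`),
  `torusKernel145M_eq_periodise (ha : 0 < a)` and **`inverse145_torusKernelM_decay (ha : 0 < a₋)`**: the same decay
  `≤ c⁻¹ · periodConst κ d · e^{−(κ/(d+1))|x|_∞}` for all `N_μ ≥ 1`, `2|x_μ| ≤ N_μ`, with the SAME constants — uniform in `k` and in
  the whole period vector.
* THE TORUS METRIC (v3, after the last section; via `B4TorusKernel` §8): `torusKernel145M_translate` (`N_μ`-periodicity in each
  `x_μ`) and **`inverse145_torusKernelM_decay_torusMetric (ha : 0 < a₋)`**: for all `N_μ ≥ 1` and EVERY `x ∈ ℤ^{d+1}` (no centring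
  hypothesis) `‖torusKernel145M n a N x‖ ≤ c⁻¹ · periodConst κ d · e^{−(κ/(d+1)) · torusSupNorm N x}`, `MultiPeriod.torusSupNorm N x =
  max_μ dist(x_μ, N_μℤ)` the sup-distance IN THE TORUS METRIC between the classes of `x` and `0` — same constants, uniform in `k` and in
  the period vector; `inverse145_torusKernelM_decay_of_torusMetric` recovers the centred form.

NOT covered (stated so that no consumer over-reads this file): the `η`-lattice rescaling (unit lattice only, as on p. 25 l. 35), the composition `P = G′Q′*(Q′G′²Q′*)⁻¹Q′G′` and
`∂P∂*` of (1.126)–(1.127) and the Hölder part (1.127).  Value = kernel certificate (joiner) of a located by-reference step,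
NOT summit progress.  Unit b2b-balaban-pv17 (surge node prover #17 gen 2); staged byte-identically under `HOME/lean/BalabanYm4/`.
-/

namespace Literature.MathematicalPhysics.QuantumFieldTheory.Balaban1983to89.B5Torus145Decay

open Complex Set UnitAddTorus
open Literature.MathematicalPhysics.QuantumFieldTheory.Balaban1983to89.B4Strip
open Literature.MathematicalPhysics.QuantumFieldTheory.Balaban1983to89.B4StripCauchy
open Literature.MathematicalPhysics.QuantumFieldTheory.Balaban1983to89.B5Strip145
open Literature.MathematicalPhysics.QuantumFieldTheory.Balaban1983to89.B5Strip145Leaves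
open Literature.MathematicalPhysics.QuantumFieldTheory.Balaban1983to89.B5Strip145Analytic
open Literature.MathematicalPhysics.QuantumFieldTheory.Balaban1983to89.B5Strip145Decay
open Literature.MathematicalPhysics.QuantumFieldTheory.Balaban1983to89.B4ContourShift
open Literature.MathematicalPhysics.QuantumFieldTheory.Balaban1983to89.B4TorusKernel
open scoped Real

noncomputable section

variable {d : ℕ}

/-- THE DUAL-TORUS MOMENTA: for `j < N` the representative of `j/N` in `[-1/2, 1/2)` is `m/N` with `m ∈ {j, j − N}`,
`−N ≤ 2m < N` — so `2π rep(j/N) ∈ (2π/N)ℤ ∩ [−π, π)`, B5 (1.29) with `η = 1`, `N = 2L′`. [cite: Balaban1984PropagatorsI, p. 23 (1.29),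
dictionary] [folklore] -/
theorem rep_grid {N : ℕ} (hN : 1 ≤ N) (j : Fin N) :
    ∃ m : ℤ, rep ((((j : ℕ) : ℝ) / N : ℝ) : UnitAddCircle) = (m : ℝ) / N ∧ -(N : ℤ) ≤ 2 * m ∧ 2 * m < N := by
  have hNpos : (0 : ℝ) < N := by exact_mod_cast hN
  have hj : ((j : ℕ) : ℝ) < N := by exact_mod_cast j.isLt
  have hj0 : (0 : ℝ) ≤ ((j : ℕ) : ℝ) := by positivity
  by_cases hlt : 2 * ((j : ℕ) : ℤ) < N
  · refine ⟨(j : ℕ), ?_, by omega, hlt⟩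
    have hlt' : 2 * ((j : ℕ) : ℝ) < N := by exact_mod_cast hlt
    rw [rep_coe ⟨by rw [le_div_iff₀ hNpos]; linarith, by rw [div_lt_iff₀ hNpos]; linarith⟩]
    push_cast
    rfl
  · refine ⟨(j : ℕ) - N, ?_, by omega, by omega⟩
    have hge : (N : ℝ) ≤ 2 * ((j : ℕ) : ℝ) := by
      have : (N : ℤ) ≤ 2 * ((j : ℕ) : ℤ) := not_lt.mp hlt
      exact_mod_cast this
    have e : ((((j : ℕ) : ℝ) / N : ℝ) : UnitAddCircle) = ((((j : ℕ) : ℝ) / N - 1 : ℝ) : UnitAddCircle) := by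
      rw [show (((j : ℕ) : ℝ) / N : ℝ) = (((j : ℕ) : ℝ) / N - 1) + 1 by ring, AddCircle.coe_add_period]
      ring_nf
    rw [e, rep_coe ⟨by rw [le_sub_iff_add_le, le_div_iff₀ hNpos]; linarith,
      by rw [sub_lt_iff_lt_add, div_lt_iff₀ hNpos]; linarith⟩]
    push_cast
    field_simp

/-- THE FINITE-TORUS KERNEL OF `(Q′G′²Q′*)⁻¹` (B5 (1.45) on the torus of p. 25 l. 35–36, equal periods `N`): at lattice separation
`x ∈ ℤ^{d+1}`, `N^{-(d+1)} Σ_{k ∈ (ℤ/N)^{d+1}} (mReg_{n,a}(p′_k))⁻¹ e^{i p′_k · x}`, `p′_k = 2π rep(k/N) ∈ (2π/N)ℤ^{d+1} ∩ [−π,π)^{d+1}`.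
[cite: Balaban1984PropagatorsI, (1.45) p. 26 with p. 25 l. 35–36, dictionary] [folklore] -/
def torusKernel145 (n : ℕ) [NeZero n] (a : ℝ) (N : ℕ) (x : Fin (d + 1) → ℤ) : ℂ :=
  ((N : ℂ) ^ (d + 1))⁻¹ * ∑ k : Fin (d + 1) → Fin N,
    (mReg n a (ofRealVec (fun i => 2 * π * rep (gridPt N k i))))⁻¹ * mFourier x (gridPt N k)

/-- the finite-torus kernel is the engine's `torusKernel` of the descended inverse multiplier (definitional). [folklore] -/
theorem torusKernel145_eq_torusKernel (n : ℕ) [NeZero n] (a : ℝ) {κ M : ℝ}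
    (hreg : StripRegular (d := d) (fun p : Fin (d + 1) → ℂ => (mReg n a p)⁻¹) κ M) (hκ : 0 ≤ κ)
    (N : ℕ) (x : Fin (d + 1) → ℤ) :
    torusKernel145 n a N x = torusKernel (descendC _ hreg hκ) N x := rfl

/-- a zero-free uniform strip for the single value `a > 0` makes `1/mReg_{n,a}` strip regular with a POSITIVE half-width, for
every `n ≥ 1`. [folklore] -/
theorem exists_stripRegular_inverse145 {a : ℝ} (ha : 0 < a) :
    ∃ κ c : ℝ, 0 < κ ∧ 0 < c ∧ ∀ (n : ℕ) [NeZero n],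
      StripRegular (d := d) (fun p : Fin (d + 1) → ℂ => (mReg n a p)⁻¹) κ c⁻¹ := by
  obtain ⟨κ₁, c, C, hκ₁, hc, h⟩ := uniformStrip145_holds (d + 1) a a ha
  refine ⟨min κ₁ (rOf (d + 1)), c, lt_min hκ₁ (rOf_pos _), hc, ?_⟩
  intro n _
  have hκ0 : 0 ≤ min κ₁ (rOf (d + 1)) := (lt_min hκ₁ (rOf_pos _)).le
  have hsub : Strip (d + 1) (min κ₁ (rOf (d + 1))) ⊆ Strip (d + 1) κ₁ := strip_mono (min_le_left _ _)
  exact stripRegular_inverse145 n a hκ0 (min_le_right _ _) hc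
    (fun p hp => ⟨(h n a le_rfl le_rfl p (hsub hp)).1, (h n a le_rfl le_rfl p (hsub hp)).2.1⟩)

/-- **"RELATING G ON THE TORUS TO G ON THE WHOLE LATTICE IN THE USUAL WAY"** (B5 p. 36 l. 20–23) for the factor `(Q′G′²Q′*)⁻¹`:
the finite-torus kernel is the periodisation of the infinite-volume kernel,
`torusKernel145 n a N x = Σ_{m ∈ ℤ^{d+1}} latticeKernel (1/mReg_{n,a}) (x + Nm)`, for every `a > 0`, `n ≥ 1`, `N ≥ 1`, `x`.
[cite: Balaban1984PropagatorsI, p. 36 l. 20–23; proof supplied by the audit, not printed] -/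
theorem torusKernel145_eq_periodise (n : ℕ) [NeZero n] {a : ℝ} (ha : 0 < a) {N : ℕ} (hN : 1 ≤ N)
    (x : Fin (d + 1) → ℤ) :
    torusKernel145 n a N x
      = ∑' m : Fin (d + 1) → ℤ, latticeKernel (fun p : Fin (d + 1) → ℂ => (mReg n a p)⁻¹) (translate N x m) := by
  obtain ⟨κ, c, hκ, _, hreg⟩ := exists_stripRegular_inverse145 (d := d) ha
  rw [torusKernel145_eq_torusKernel n a (hreg n) hκ.le N x]
  exact torusKernel_descend_eq (hreg n) hκ hN x

/-- **THE `k`- AND VOLUME-UNIFORM EXPONENTIAL DECAY OF THE FINITE-TORUS KERNEL OF `(Q′G′²Q′*)⁻¹` (the input of B5 (1.126) for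
the factor (1.45); p. 38 "the analyticity method of proving an exponential decay", p. 36 "relating G on the torus to G on the
whole lattice … in the usual way").**  For `0 < a₋ ≤ a₊` there are `κ > 0` and `c > 0` such that for EVERY `n = L^k ≥ 1`, every
`a ∈ [a₋, a₊]`, every period `N ≥ 1` and every centred separation `x` (`2|x_i| ≤ N`):
`‖torusKernel145 n a N x‖ ≤ c⁻¹ · periodConst κ d · e^{−(κ/(d+1)) |x|_∞}` — constants depending on `d, a₋, a₊` only.
ONLY HYPOTHESIS: `0 < a₋`.  Assembled from `B5Strip145Decay.stripRegular_inverse145` + `B5Strip145Leaves.uniformStrip145_holds`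
(zero-free uniform strip) and the generic engines `B4ContourShift` (contour shift) / `B4TorusKernel` (Poisson periodisation).
[cite: Balaban1984PropagatorsI, (1.45) p. 26, p. 36 l. 20–23 and p. 38 (the sentence before (1.126)); proof supplied by the
audit, not printed] -/
theorem inverse145_torusKernel_decay (d : ℕ) (aminus aplus : ℝ) (ha : 0 < aminus) :
    ∃ κ c : ℝ, 0 < κ ∧ 0 < c ∧ ∀ (n : ℕ) [NeZero n] (a : ℝ), aminus ≤ a → a ≤ aplus →
      ∀ N : ℕ, 1 ≤ N → ∀ x : Fin (d + 1) → ℤ, (∀ i, 2 * |x i| ≤ N) →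
        ‖torusKernel145 n a N x‖ ≤ c⁻¹ * periodConst κ d * Real.exp (-(κ / (d + 1) * supNorm x)) := by
  obtain ⟨κ₁, c, C, hκ₁, hc, h⟩ := uniformStrip145_holds (d + 1) aminus aplus ha
  refine ⟨min κ₁ (rOf (d + 1)), c, lt_min hκ₁ (rOf_pos _), hc, ?_⟩
  intro n _ a ha1 ha2 N hN x hx
  have hκ : 0 < min κ₁ (rOf (d + 1)) := lt_min hκ₁ (rOf_pos _)
  have hsub : Strip (d + 1) (min κ₁ (rOf (d + 1))) ⊆ Strip (d + 1) κ₁ := strip_mono (min_le_left _ _)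
  have hreg := stripRegular_inverse145 (d := d) n a hκ.le (min_le_right _ _) hc
    (fun p hp => ⟨(h n a ha1 ha2 p (hsub hp)).1, (h n a ha1 ha2 p (hsub hp)).2.1⟩)
  rw [torusKernel145_eq_torusKernel n a hreg hκ.le N x]
  exact torusKernel_descend_decay hreg hκ hN x hx

/-! ### Unequal periods (v2): the torus `Π_μ ℤ/N_μ` of B5 p. 17 l. 30 (`−L_μ ≤ x_μ < L_μ`) and p. 23 (1.29) (`−L′_μ ≤ n_μ < L′_μ`)

The same three statements for a period VECTOR `N : Fin (d+1) → ℕ` (all `N_μ ≥ 1`), through the `MultiPeriod` section (§7, v3) of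
`B4TorusKernel`; the constants are those of the equal-period case and do not depend on the period vector. -/

/-- THE FINITE-TORUS KERNEL OF `(Q′G′²Q′*)⁻¹` ON `Π_μ ℤ/N_μ` (μ-dependent periods, B5 p. 17 l. 30 / (1.29)): at lattice separation
`x ∈ ℤ^{d+1}`, `(Π_μ N_μ)^{-1} Σ_{k ∈ Π_μ ℤ/N_μ} (mReg_{n,a}(p′_k))⁻¹ e^{i p′_k · x}`, `p′_{k,μ} = 2π rep(k_μ/N_μ) ∈ (2π/N_μ)ℤ ∩ [−π,π)`.
[cite: Balaban1984PropagatorsI, (1.45) p. 26 with p. 23 (1.29) and p. 25 l. 35–36, dictionary] [folklore] -/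
def torusKernel145M (n : ℕ) [NeZero n] (a : ℝ) (N : Fin (d + 1) → ℕ) (x : Fin (d + 1) → ℤ) : ℂ :=
  (∏ i, ((N i : ℕ) : ℂ))⁻¹ * ∑ k : (i : Fin (d + 1)) → Fin (N i),
    (mReg n a (ofRealVec (fun i => 2 * π * rep (MultiPeriod.gridPt N k i))))⁻¹ * mFourier x (MultiPeriod.gridPt N k)

/-- the multi-period finite-torus kernel is the engine's `MultiPeriod.torusKernel` of the descended inverse multiplier
(definitional). [folklore] -/
theorem torusKernel145M_eq_torusKernel (n : ℕ) [NeZero n] (a : ℝ) {κ M : ℝ}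
    (hreg : StripRegular (d := d) (fun p : Fin (d + 1) → ℂ => (mReg n a p)⁻¹) κ M) (hκ : 0 ≤ κ)
    (N : Fin (d + 1) → ℕ) (x : Fin (d + 1) → ℤ) :
    torusKernel145M n a N x = MultiPeriod.torusKernel (descendC _ hreg hκ) N x := rfl

/-- consistency: for the constant period vector the multi-period kernel is `torusKernel145`. [folklore] -/
theorem torusKernel145M_const (n : ℕ) [NeZero n] (a : ℝ) (N : ℕ) (x : Fin (d + 1) → ℤ) :
    torusKernel145M n a (fun _ => N) x = torusKernel145 n a N x := by
  unfold torusKernel145M torusKernel145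
  rw [Finset.prod_const, Finset.card_univ, Fintype.card_fin]
  rfl

/-- "relating G on the torus to G on the whole lattice in the usual way" (B5 p. 36 l. 20–23), unequal periods:
`torusKernel145M n a N x = Σ_{m ∈ ℤ^{d+1}} latticeKernel (1/mReg_{n,a}) (x + (N_μ m_μ)_μ)` for `a > 0`, `n ≥ 1`, all `N_μ ≥ 1`.
[cite: Balaban1984PropagatorsI, p. 36 l. 20–23; proof supplied by the audit, not printed] -/
theorem torusKernel145M_eq_periodise (n : ℕ) [NeZero n] {a : ℝ} (ha : 0 < a) {N : Fin (d + 1) → ℕ} (hN : ∀ i, 1 ≤ N i)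
    (x : Fin (d + 1) → ℤ) :
    torusKernel145M n a N x
      = ∑' m : Fin (d + 1) → ℤ, latticeKernel (fun p : Fin (d + 1) → ℂ => (mReg n a p)⁻¹) (MultiPeriod.translate N x m) := by
  obtain ⟨κ, c, hκ, _, hreg⟩ := exists_stripRegular_inverse145 (d := d) ha
  rw [torusKernel145M_eq_torusKernel n a (hreg n) hκ.le N x]
  exact MultiPeriod.torusKernel_descend_eq (hreg n) hκ hN x

/-- **`k`- AND VOLUME-UNIFORM EXPONENTIAL DECAY OF THE FINITE-TORUS KERNEL OF `(Q′G′²Q′*)⁻¹` ON `Π_μ ℤ/N_μ`** (μ-dependent periods,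
the tori actually written in B5, p. 17 l. 30 and (1.29)).  For `0 < a₋ ≤ a₊` there are `κ > 0`, `c > 0` such that for EVERY `n = L^k ≥ 1`,
every `a ∈ [a₋, a₊]`, every period vector with all `N_μ ≥ 1` and every centred separation `x` (`2|x_μ| ≤ N_μ`):
`‖torusKernel145M n a N x‖ ≤ c⁻¹ · periodConst κ d · e^{−(κ/(d+1)) |x|_∞}` — constants depending on `d, a₋, a₊` only, the same as in
`inverse145_torusKernel_decay`.  ONLY HYPOTHESIS: `0 < a₋`. [cite: Balaban1984PropagatorsI, (1.45) p. 26, p. 36 l. 20–23 and p. 38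
(the sentence before (1.126)); proof supplied by the audit, not printed] -/
theorem inverse145_torusKernelM_decay (d : ℕ) (aminus aplus : ℝ) (ha : 0 < aminus) :
    ∃ κ c : ℝ, 0 < κ ∧ 0 < c ∧ ∀ (n : ℕ) [NeZero n] (a : ℝ), aminus ≤ a → a ≤ aplus →
      ∀ N : Fin (d + 1) → ℕ, (∀ i, 1 ≤ N i) → ∀ x : Fin (d + 1) → ℤ, (∀ i, 2 * |x i| ≤ N i) →
        ‖torusKernel145M n a N x‖ ≤ c⁻¹ * periodConst κ d * Real.exp (-(κ / (d + 1) * supNorm x)) := by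
  obtain ⟨κ₁, c, C, hκ₁, hc, h⟩ := uniformStrip145_holds (d + 1) aminus aplus ha
  refine ⟨min κ₁ (rOf (d + 1)), c, lt_min hκ₁ (rOf_pos _), hc, ?_⟩
  intro n _ a ha1 ha2 N hN x hx
  have hκ : 0 < min κ₁ (rOf (d + 1)) := lt_min hκ₁ (rOf_pos _)
  have hsub : Strip (d + 1) (min κ₁ (rOf (d + 1))) ⊆ Strip (d + 1) κ₁ := strip_mono (min_le_left _ _)
  have hreg := stripRegular_inverse145 (d := d) n a hκ.le (min_le_right _ _) hc
    (fun p hp => ⟨(h n a ha1 ha2 p (hsub hp)).1, (h n a ha1 ha2 p (hsub hp)).2.1⟩)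
  rw [torusKernel145M_eq_torusKernel n a hreg hκ.le N x]
  exact MultiPeriod.torusKernel_descend_decay hreg hκ hN x hx

/-! ### The torus metric (v3): `N_μ`-periodicity of `torusKernel145M` and decay at EVERY lattice point

With §8 of `B4TorusKernel` (`MultiPeriod.torusSupNorm N x = max_μ dist(x_μ, N_μℤ)`, the sup-distance on `Π_μ ℤ/N_μ` between the
classes of `x` and `0`; `MultiPeriod.torusKernel_translate`): the finite-torus kernel of `(Q′G′²Q′*)⁻¹` is `N_μ`-periodic in each `x_μ`
and decays IN THE TORUS METRIC at every `x ∈ ℤ^{d+1}` — no centring hypothesis — with the constants of `inverse145_torusKernelM_decay`. -/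

/-- PERIODICITY: `torusKernel145M n a N (x + (N_μ m_μ)_μ) = torusKernel145M n a N x`. [folklore] -/
theorem torusKernel145M_translate (n : ℕ) [NeZero n] (a : ℝ) {N : Fin (d + 1) → ℕ} (hN : ∀ i, 1 ≤ N i)
    (x m : Fin (d + 1) → ℤ) : torusKernel145M n a N (MultiPeriod.translate N x m) = torusKernel145M n a N x := by
  unfold torusKernel145M
  congr 1
  exact Finset.sum_congr rfl fun k _ => by rw [MultiPeriod.mFourier_translate_gridPt hN x m k]

/-- **`k`- AND VOLUME-UNIFORM DECAY OF THE TORUS KERNEL OF `(Q′G′²Q′*)⁻¹` IN THE TORUS METRIC, AT EVERY LATTICE POINT**: for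
`0 < a₋ ≤ a₊` there are `κ > 0`, `c > 0` (those of `inverse145_torusKernelM_decay`: depending on `d, a₋, a₊` only) such that for every
`n = L^k ≥ 1`, every `a ∈ [a₋, a₊]`, every period vector with all `N_μ ≥ 1` and EVERY `x ∈ ℤ^{d+1}`:
`‖torusKernel145M n a N x‖ ≤ c⁻¹ · periodConst κ d · e^{−(κ/(d+1)) · torusSupNorm N x}`, where
`MultiPeriod.torusSupNorm N x = max_μ dist(x_μ, N_μℤ)` is the torus sup-distance between the classes of `x` and `0` (for a separation
`x = y − y′`: between the sites `y`, `y′` of the torus `Π_μ ℤ/N_μ`).  Periodicity + the centred statement at the centred representative.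
ONLY HYPOTHESIS: `0 < a₋`. [cite: Balaban1984PropagatorsI, (1.45) p. 26, p. 36 l. 20–23 and p. 38 (the sentence before (1.126));
proof supplied by the audit, not printed] -/
theorem inverse145_torusKernelM_decay_torusMetric (d : ℕ) (aminus aplus : ℝ) (ha : 0 < aminus) :
    ∃ κ c : ℝ, 0 < κ ∧ 0 < c ∧ ∀ (n : ℕ) [NeZero n] (a : ℝ), aminus ≤ a → a ≤ aplus →
      ∀ N : Fin (d + 1) → ℕ, (∀ i, 1 ≤ N i) → ∀ x : Fin (d + 1) → ℤ,
        ‖torusKernel145M n a N x‖ ≤ c⁻¹ * periodConst κ d * Real.exp (-(κ / (d + 1) * MultiPeriod.torusSupNorm N x)) := by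
  obtain ⟨κ, c, hκ, hc, h⟩ := inverse145_torusKernelM_decay d aminus aplus ha
  refine ⟨κ, c, hκ, hc, ?_⟩
  intro n _ a ha1 ha2 N hN x
  rw [← torusKernel145M_translate n a hN x (MultiPeriod.centreVec N x), ← MultiPeriod.supNorm_translate_centreVec hN x]
  exact h n a ha1 ha2 N hN _ (MultiPeriod.translate_centreVec_centred hN x)

/-- the torus-metric statement CONTAINS the centred one (v2 `inverse145_torusKernelM_decay`): on centred representatives
`torusSupNorm N x = |x|_∞` (`MultiPeriod.torusSupNorm_of_centred`). (Reader's convenience.) [folklore] -/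
theorem inverse145_torusKernelM_decay_of_torusMetric (d : ℕ) (aminus aplus : ℝ) (ha : 0 < aminus) :
    ∃ κ c : ℝ, 0 < κ ∧ 0 < c ∧ ∀ (n : ℕ) [NeZero n] (a : ℝ), aminus ≤ a → a ≤ aplus →
      ∀ N : Fin (d + 1) → ℕ, (∀ i, 1 ≤ N i) → ∀ x : Fin (d + 1) → ℤ, (∀ i, 2 * |x i| ≤ N i) →
        ‖torusKernel145M n a N x‖ ≤ c⁻¹ * periodConst κ d * Real.exp (-(κ / (d + 1) * supNorm x)) := by
  obtain ⟨κ, c, hκ, hc, h⟩ := inverse145_torusKernelM_decay_torusMetric d aminus aplus ha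
  refine ⟨κ, c, hκ, hc, ?_⟩
  intro n _ a ha1 ha2 N hN x hx
  rw [← MultiPeriod.torusSupNorm_of_centred hN hx]
  exact h n a ha1 ha2 N hN x

end

end Literature.MathematicalPhysics.QuantumFieldTheory.Balaban1983to89.B5Torus145Decay
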